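import Literature.MathematicalPhysics.QuantumFieldTheory.Balaban1983to89.B8Thm2SetupTorus
import Literature.MathematicalPhysics.QuantumFieldTheory.Balaban1983to89.B8Eq166ConstraintPair
import Literature.MathematicalPhysics.QuantumFieldTheory.Balaban1983to89.B7AvgClosedSpecialUnitarySharp
import Literature.MathematicalPhysics.QuantumFieldTheory.Balaban1983to89.B8Ineq1144TwistedAxial
import Literature.MathematicalPhysics.QuantumFieldTheory.Balaban1983to89.T3SectALandauChart
import Summits.QuantumFields.YangMills.Theorems.UnitScaleTiltProp7AxialGaugeFace
import Summits.QuantumFields.YangMills.Theorems.UnitScaleTiltProp7ChartInjectivityPrint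
import HarnessLib

/-!
# Route `UnitScaleTilt`, crux K1 child «MinimiserStabilityRegPr» (stmt-QuantumFields-19200), registered stub `stub_prop7From14` (skeleton birth_v7
# cc37a178…; leaf V3) — BOTH LAWS OF THE CORRECTED KNIT PROVED FOR PRINT'S PRESENTATION AT THE T³ CARRIER: the (4)-representative in the axial
# gauge (1.19) of [Balaban1985RegularSpaces] EXISTS (small-field regime) and the chart map is ONE-TO-ONE, for the letters of [Balaban1985RegularSpaces]
# (1.19) ∕ (1.29) read on the periodic `ℤᵈ` pullbacks BASED AT THE `k`-CENTRE `x₀ = embIter k 0`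

Cell `ym3-torus` ∕ fleet seat `ym-ust-19200-p1` (gen 8; HUMAN RULING D-0037, YM ladder rung R3; director-ym 2026-08-27 20:03Z (ii)).  WHY.  The
corrected knit `Prop7ChartInjectivity.prop7From14At_of_props_inj` (this seat, p567142) closes the leaf V3 from Props 2, 5, 6 at a presentation `S`
plus two laws: (a) the CONDITIONAL axial-representative law ([Balaban1985RegularSpaces] p. 79 «The conditions (1.19) determine uniquely an element
in each orbit given by the subgroup (1.14)», for `U ∈ (6)(ε₀)`, `U₀` with (14), `ε₀` small) and (b) print's injectivity law ([Balaban1985Variational]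
p. 281 «The above mapping is one-to-one»).  THIS FILE proves (a) and (b) for print's letters — `IsAxial` := (1.19) = `B8Eq119TwistedAxial.InAx`,
`Restricted` := (1.29) = `B8Eq119TwistedAxial.Restr129` ([Balaban1985Averaging] (78)–(81)), both read on the periodic pullbacks of the torus
configurations BASED AT `x₀ = embIter k 0`.  LOCATED (why based, not the B8 lane's origin-based `B8Thm2SetupTorus.InAxT`∕`Restr129T`): the `ℤᵈ`
files pin the subgroup (1.14) at the block CORNERS `Lᵏz` ([Balaban1985Averaging]'s corner convention), while the T³ carrier's group (4)
(`T3PrintedRegularOrbits.descTransf u = 1`) pins the block CENTRES `embIter k y` (`Setup.emb`, centred convention, DIVERGENCE F3 of `Setup`); based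
at `x₀` the `ℤᵈ` corners `Lᵏz` ARE the centres (`embIter_eq_transl`), so the pinned twisted fix `B8Eq166ConstraintPair.ptw` (= 1 on `Lᵏℤᵈ`,
periodic, `SU(N)`-valued, (1.19) at every block in the Prop.-2 window) descends to an element of the group (4).  The origin-based letters describe the
translate by half a block; [Balaban1985RegularSpaces] Thm 2 for the based letters is the B8 lane's `Thm2SetupSUAt` applied to translated configurations
(torus homogeneity) — a dictionary owed, not filed here.

WHAT IS PROVED (sorry-free, no definition; `Site` = torus sites, `LSite` = `ℤᵈ`).
§1 `embIter_eq_transl`: `embIter k y = x₀ + Lᵏ·ỹ` (`Prop7AxialGaugeFace.exists_off_embIter`).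
§2 based pullbacks: `pull_toUField_mem` (`SU(N)`-valued), `pull_periodic_pow` (period `N_k·Lᵏ = sitesPerDir 0`), `norm_plaqF_pull_sub_one_lt` ∕
   `pdev_pull_lt` ((1.7) from the origin-based class `InAk` to ANY base: `sup_p |V♯(∂p) − 1| < 2αL^{−2k}`), `exists_su_gauge_of_periodic` (descent of a
   periodic `SU(N)`-valued `ℤᵈ` gauge transformation, based), `eq_one_of_pullGauge_eq`, `pull_toUField_gaugeAct` (the based
   pullback of `U^v` is `(U♯)^{v♯}`).
§3 **`exists_repr_inAx_based`** (Setup torus, `SU(N)`, `N ≤ 21` for `AvgClosed`, [Balaban1985Averaging] Prop. 2 window `C₀·2α ≤ ⅓`, `4α ≤ c₂′`, data in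
   `𝔄_k(α)`): a gauge transformation `v`, `= 1` AT EVERY `k`-CENTRE, with `U^v ∈ Ax_k(Λ, U₀)` in the based reading, every `Λ`.
§4 T³: `inAk_pull_of_regPr` ((2) ⟹ `𝔄_k`), **`axialRepr_print_based`**: the law (a) in the knit's binder shape (with `B₃ε₁ ≤ ε₀`; threshold
   `e = min{1/(6C₀C₁), c₂′/(4C₁)}`), for every `S` whose `IsAxial` is implied by the based (1.19)-reading.
§5 **`eq_of_inAx_restr129_based`** (any base point; `ℤᵈ` core `Prop7ChartInjectivityPrint.eq_of_inAx_restr129`) and **`inj16_print_based`**: the law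
   (b) in the knit's binder shape, for every `S` whose `IsAxial` ∕ `Restricted` imply the based readings.

HONEST SCOPE.  The regime is print's: `U ∈ (6)(ε₀)`, `U₀ ∈ 𝔘_k(C₁B₃ε₁)` with `B₃ε₁ ≤ ε₀ ≤ e` ([Balaban1985Averaging] Prop. 2 for the averages
entering (1.19); the tree's logarithm is the series one).  Nothing of [Balaban1985RegularSpaces] Thm 2 ∕ [Balaban1985Variational] Props 5–6 is
claimed; the based-vs-origin translation dictionary for Thm 2 and the (0.4)-vs-[B7] averaging port stay owed.  Count-neutral helper toward
stmt-QuantumFields-19200 (`--supports`), not a proof of the stub.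

References: T. Bałaban, CMP 99 (1985) 75–102 [Balaban1985RegularSpaces] ((1.3) p.77, (1.7) p.77, (1.14) p.78, (1.19)–(1.20) p.79, (1.29) p.81);
CMP 102 (1985) 277–309 [Balaban1985Variational] ((4) p.278, (14)–(18) p.280, p.281); CMP 98 (1985) 17–51 [Balaban1985Averaging] ((8) p.19, (19) p.21,
Prop. 2 (52)–(53) p.26, (78)–(81) p.30, (87) p.31); [Balaban1987RG1] (0.1) p.252 (centres of cubes).
-/

noncomputable section

namespace Summit.QuantumFields.YangMills.Theorems.Prop7AxialReprPrint

open Literature.MathematicalPhysics.QuantumFieldTheory.Balaban1983to89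
open B7Prop1Explicit renaming Site → LSite
open B7Prop1Explicit (e boxVec)
open B7Prop2Explicit (avgIter pdev C0 c2' C0_pos c2'_pos AvgClosed)
open B7Prop2SpecialUnitary (specialUnitaryUnits mem_specialUnitaryUnits specialUnitaryUnits_le_unitaryUnits)
open B12Ineq417Flat (shiftCfg shiftCfg_apply)
open B8Ineq132 (InAk plaqF)
open B8Eq119TwistedAxial (InAx)
open B8Eq166ConstraintPair (ptw ptw_top ptw_periodic pinnedTwistedFix_global inAx_pinnedTwistedFix)
open B8Ineq1144TwistedAxial (pdev_le_of_forall)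
open B8Thm4TorusAt (torusLam)
open B15DeterminingSets (embIter)
open B10Eq27TorusAxialLog (transl transl_apply transl_zero transl_add transl_rel rel pull pull_apply gaugeActT gaugeActT_apply gaugeActT_eq_gaugeAct
  pull_gaugeActT unitsField val_unitsField toUField suIncl val_suIncl)
open B10Eq68TorusRegularity (plaqFT plaqF_pull InSpace)
open B8Thm2SetupTorus (pullGauge pullGauge_apply pull_periodic descendGauge descendGauge_apply pullGauge_descendGauge
  inSpace_univ_iff_inAk_pull unitsField_toUField_mem toUGauge)
open Summit.QuantumFields.YangMills.Theorems.Prop7AxialGaugeFace (exists_off_embIter)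
open Summit.QuantumFields.YangMills.Theorems.Prop7FlatHolonomy (sitesPerDir_zero_eq_mul_pow transfUp_eq_embIter)

/-! ## §1 Geometry: the `k`-fold centres of the torus are the translates of `embIter k 0` by `Lᵏℤᵈ` -/

section Geometry

variable {P : Params}

/-- **THE `k`-CENTRES ARE `x₀ + Lᵏℤᵈ`, `x₀ = embIter k 0`**: `embIter k y = x₀ + Lᵏ·ỹ` with `ỹ_μ` the label of `y_μ` (uniform centre offset,
`Prop7AxialGaugeFace.exists_off_embIter`). [cite: Balaban1987RG1, (0.1) p.252] -/
theorem embIter_eq_transl {k : ℕ} (hk : k ≤ P.m + P.K) (y : Site P k) :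
    embIter k y = transl (embIter k (0 : Site P k)) (((P.L : ℤ) ^ k) • fun μ => ((y μ).val : ℤ)) := by
  obtain ⟨off, _, hoff⟩ := exists_off_embIter k hk
  funext μ
  rw [transl_apply, ← ZMod.natCast_zmod_val ((embIter k y) μ), ← ZMod.natCast_zmod_val ((embIter k (0 : Site P k)) μ), hoff, hoff]
  have h0 : ((0 : Site P k) μ).val = 0 := by
    show ((0 : ZMod (P.sitesPerDir k))).val = 0
    exact ZMod.val_zero
  rw [h0, zero_mul, zero_add]
  push_cast
  simp only [Pi.smul_apply, smul_eq_mul, Int.cast_mul, Int.cast_pow, Int.cast_natCast]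
  ring

end Geometry

/-! ## §2 The periodic pullback BASED AT A TORUS SITE `x₀`: group membership, periodicity, plaquette smallness -/

section Pullback

open scoped Matrix.Norms.L2Operator

variable {P : Params} {N : ℕ}

/-- The pullback of an `SU(N)` torus configuration (read in the units of `M_N(ℂ)`) is `SU(N)`-valued. [cite: Balaban1985Averaging, (19) p.21] -/
theorem pull_toUField_mem (U : GaugeField P 0 (Matrix.specialUnitaryGroup (Fin N) ℂ)) (x₀ : Site P 0) (z : LSite P.d) (κ : Fin P.d) :
    pull (unitsField (toUField U)) x₀ z κ ∈ specialUnitaryUnits (Fin N) := by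
  rw [pull_apply]
  exact unitsField_toUField_mem U _

/-- The pullback based at any site is `N_k·Lᵏ`-periodic, `N_k = sitesPerDir k` (`sitesPerDir 0 = N_k·Lᵏ`, `k ≤ m + K`).
[cite: Balaban1985RegularSpaces, (1.3) p.77] -/
theorem pull_periodic_pow {G : Type*} {k : ℕ} (hk : k ≤ P.m + P.K) (V : GaugeField P 0 G) (x₀ : Site P 0) (i : Fin P.d) :
    shiftCfg (((P.sitesPerDir k * P.L ^ k : ℕ) : ℤ) • e i) (pull V x₀) = pull V x₀ := by
  rw [← sitesPerDir_zero_eq_mul_pow hk]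
  exact pull_periodic V x₀ i

/-- **PLAQUETTE SMALLNESS OF THE BASED PULLBACK FROM THE ORIGIN-BASED CLASS `InAk`** (all-torus geometry): the plaquette of `V♯_{x₀}` at `z` is the
torus plaquette at `x₀ + z`, which is the plaquette of `V♯_0` at `(x₀ + z) − 0` (`B10Eq68TorusRegularity.plaqF_pull` twice).
[cite: Balaban1985RegularSpaces, (1.7) p.77] -/
theorem norm_plaqF_pull_sub_one_lt {𝔸 : Type*} [NormedRing 𝔸] [NormedAlgebra ℂ 𝔸] [CompleteSpace 𝔸] {k : ℕ} {η α : ℝ}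
    {V : GaugeField P 0 𝔸ˣ} (h : InAk P.L k η α (fun _ => (Set.univ : Set (LSite P.d))) (pull V 0)) (x₀ : Site P 0)
    (z : LSite P.d) {μ ν : Fin P.d} (hne : μ ≠ ν) :
    ‖plaqF (pull V x₀) μ ν z - 1‖ < α * (((P.L : ℝ) ^ k)⁻¹) ^ 2 := by
  have h0 := (h k le_rfl).1 (rel 0 (transl x₀ z)) μ ν hne (Or.inl (Set.mem_univ _))
  rw [plaqF_pull, transl_rel] at h0
  rwa [plaqF_pull]

/-- … hence `sup_p |V♯_{x₀}(∂p) − 1| < 2α·L^{−2k}` (`B8Ineq1144TwistedAxial.pdev_le_of_forall`; the factor `2` turns `≤ α` into a strict bound,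
`α > 0`, `L ≥ 1`). [cite: Balaban1985RegularSpaces, (1.7) p.77; Balaban1985Averaging, (52) p.26] -/
theorem pdev_pull_lt {𝔸 : Type*} [NormedRing 𝔸] [NormedAlgebra ℂ 𝔸] [CompleteSpace 𝔸] {k : ℕ} {η α : ℝ} (hα : 0 < α)
    {V : GaugeField P 0 𝔸ˣ} (h : InAk P.L k η α (fun _ => (Set.univ : Set (LSite P.d))) (pull V 0)) (x₀ : Site P 0) :
    pdev (pull V x₀) < 2 * α * (((P.L : ℝ) ^ k)⁻¹) ^ 2 := by
  have hL : (1 : ℝ) ≤ (P.L : ℝ) ^ k := one_le_pow₀ (by exact_mod_cast P.hL.2.le)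
  have hpos : 0 < α * (((P.L : ℝ) ^ k)⁻¹) ^ 2 := by positivity
  have hle : pdev (pull V x₀) ≤ α * (((P.L : ℝ) ^ k)⁻¹) ^ 2 :=
    pdev_le_of_forall hpos.le fun z κ ν hκν => (norm_plaqF_pull_sub_one_lt h x₀ z hκν).le
  linarith

/-- **DESCENT OF A PERIODIC `SU(N)`-VALUED `ℤᵈ` GAUGE TRANSFORMATION TO AN `SU(N)` TORUS GAUGE TRANSFORMATION BASED AT `x₀`** whose pullback it
is (`B8Thm2SetupTorus.descendGauge` ∕ `pullGauge_descendGauge`, values packaged in `Matrix.specialUnitaryGroup`).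
[cite: Balaban1985RegularSpaces, (1.3) p.77; Balaban1985Averaging, (8) p.19] -/
theorem exists_su_gauge_of_periodic {w : LSite P.d → (Matrix (Fin N) (Fin N) ℂ)ˣ} (hw : ∀ z, w z ∈ specialUnitaryUnits (Fin N))
    (hper : ∀ (z : LSite P.d) (i : Fin P.d), w (z + ((P.sitesPerDir 0 : ℕ) : ℤ) • e i) = w z) (x₀ : Site P 0) :
    ∃ v : GaugeTransf P 0 (Matrix.specialUnitaryGroup (Fin N) ℂ),
      pullGauge (fun x => Unitary.toUnits (toUGauge P N v x)) x₀ = w := by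
  refine ⟨fun x => ⟨((w (rel x₀ x) : (Matrix (Fin N) (Fin N) ℂ)ˣ) : Matrix (Fin N) (Fin N) ℂ), (mem_specialUnitaryUnits).1 (hw _)⟩, ?_⟩
  have key := pullGauge_descendGauge (G := (Matrix (Fin N) (Fin N) ℂ)ˣ) (u := w) x₀ hper
  funext z
  have kz := congrFun key z
  rw [pullGauge_apply, descendGauge_apply] at kz
  rw [pullGauge_apply, ← kz]
  exact Units.ext rfl

/-- Reading a gauge transformation back on the torus: if `(toUnits ∘ suIncl ∘ v)♯_{x₀} = w` and `w(Lᵏz̃) = 1`, then `v(x₀ + Lᵏz̃) = 1`.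
[cite: Balaban1985RegularSpaces, (1.14) p.78] -/
theorem eq_one_of_pullGauge_eq {v : GaugeTransf P 0 (Matrix.specialUnitaryGroup (Fin N) ℂ)} {w : LSite P.d → (Matrix (Fin N) (Fin N) ℂ)ˣ}
    {x₀ : Site P 0} (hvw : pullGauge (fun x => Unitary.toUnits (toUGauge P N v x)) x₀ = w) {z : LSite P.d} (hz : w z = 1) :
    v (transl x₀ z) = 1 := by
  have h := congrFun hvw z
  rw [pullGauge_apply, hz] at h
  have h' := congrArg (fun g : (Matrix (Fin N) (Fin N) ℂ)ˣ => (g : Matrix (Fin N) (Fin N) ℂ)) h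
  simp only [Unitary.val_toUnits_apply, B8Thm2SetupTorus.toUGauge_apply, val_suIncl, Units.val_one] at h'
  exact Subtype.ext h'

/-- **THE BASED PULLBACK OF `U^v` IS `(U♯)^{v♯}`** for `SU(N)` configurations read in `U(N)` (`toUField`, `toUGauge`), any base point.
[cite: Balaban1985Averaging, (8) p.19; Balaban1985RegularSpaces, (1.3) p.77] -/
theorem pull_toUField_gaugeAct [NeZero N] (v : GaugeTransf P 0 (Matrix.specialUnitaryGroup (Fin N) ℂ))
    (U : GaugeField P 0 (Matrix.specialUnitaryGroup (Fin N) ℂ)) (x₀ : Site P 0) :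
    pull (unitsField (toUField (GaugeField.gaugeAct v U))) x₀ =
      B7Prop1Explicit.gaugeAct (pullGauge (fun x => Unitary.toUnits (toUGauge P N v x)) x₀) (pull (unitsField (toUField U)) x₀) := by
  have h1 : toUField (GaugeField.gaugeAct v U) = gaugeActT (toUGauge P N v) (toUField U) := by
    funext b
    rw [← gaugeActT_eq_gaugeAct]
    simp only [toUField, gaugeActT_apply, B8Thm2SetupTorus.toUGauge_apply, map_mul, map_inv]
  rw [h1, Summit.QuantumFields.YangMills.Theorems.Prop7ChartInjectivityPrint.unitsField_gaugeActT, pull_gaugeActT]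
  rfl

end Pullback

/-! ## §3 The (4)-representative in print's axial gauge (1.19), based letters, small-field regime -/

section Main

open scoped Matrix.Norms.L2Operator
open B7AvgClosedSpecialUnitarySharp (avgClosed_specialUnitary_of_le_twentyone)

variable {P : Params} {N : ℕ} [NeZero N]

/-- **[Balaban1985RegularSpaces] p. 79 «THE CONDITIONS (1.19) DETERMINE UNIQUELY AN ELEMENT IN EACH ORBIT GIVEN BY THE SUBGROUP (1.14)» —
EXISTENCE, AT THE SETUP-TORUS OBJECTS, FOR THE GROUP PINNED AT THE `k`-CENTRES** (`u(y) = 1` at every `y = embIter k ·`, the T³ carrier's group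
(4)), in the small-field regime.  For `SU(N)` (`N ≤ 21`) torus configurations `U₀`, `U` whose origin-based pullbacks lie in the all-torus class
`𝔄_k(α)` (`B8Ineq132.InAk`, (1.7)/(1.9)) with `α` Prop.-2-small (`C₀·2α ≤ ⅓`, `4α ≤ c₂′`), there is a gauge transformation `v`, TRIVIAL AT EVERY
`k`-CENTRE, such that `U^v` lies in the axial gauge (1.19) relative to `U₀` READ ON THE PULLBACKS BASED AT `x₀ = embIter k 0` (so that the `ℤᵈ`
block corners `Lᵏz` are the torus `k`-centres) — for every family of constraint sets `Λ`.  Construction: the pinned twisted fix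
`B8Eq166ConstraintPair.ptw` of the based pullbacks (periodic, `SU(N)`-valued, `= 1` on `Lᵏℤᵈ`), descended to the torus.
[cite: Balaban1985RegularSpaces, (1.19) p.79, (1.14) p.78, p.79 (sentence after (1.20)); Balaban1985Variational, (4) p.278, (18) p.280] -/
theorem exists_repr_inAx_based (hN : N ≤ 21) {k : ℕ} (hk : k ≤ P.m + P.K) {η α : ℝ} (hα : 0 < α)
    (hα3 : C0 P.d * (2 * α) ≤ 1 / 3) (hα2 : 2 * (2 * α) ≤ c2' P.d P.L)
    (U₀ U : GaugeField P 0 (Matrix.specialUnitaryGroup (Fin N) ℂ))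
    (h₀ : InAk P.L k η α (fun _ => (Set.univ : Set (LSite P.d))) (pull (unitsField (toUField U₀)) 0))
    (hU : InAk P.L k η α (fun _ => (Set.univ : Set (LSite P.d))) (pull (unitsField (toUField U)) 0)) :
    ∃ v : GaugeTransf P 0 (Matrix.specialUnitaryGroup (Fin N) ℂ), (∀ y : Site P k, v (embIter k y) = 1) ∧
      ∀ Λ : ℕ → Set (LSite P.d), InAx P.L k Λ (pull (unitsField (toUField U₀)) (embIter k (0 : Site P k)))
        (pull (unitsField (toUField (GaugeField.gaugeAct v U))) (embIter k (0 : Site P k))) := by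
  letI : CStarAlgebra (Matrix (Fin N) (Fin N) ℂ) := B10Eq29TubeLine.cstarAlgebraMatrix N
  set x₀ : Site P 0 := embIter k (0 : Site P k) with hx₀
  have hL2 : 2 ≤ P.L := P.hL.2
  have hL1 : 1 ≤ P.L := le_trans (by norm_num) hL2
  have hG : AvgClosed P.d P.L (specialUnitaryUnits (Fin N)) := avgClosed_specialUnitary_of_le_twentyone hN P.d P.L
  have hmem₀ : ∀ z κ, pull (unitsField (toUField U₀)) x₀ z κ ∈ specialUnitaryUnits (Fin N) := pull_toUField_mem U₀ x₀
  have hmem : ∀ z κ, pull (unitsField (toUField U)) x₀ z κ ∈ specialUnitaryUnits (Fin N) := pull_toUField_mem U x₀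
  have h2α : 0 < 2 * α := by positivity
  have h33 : pdev (pull (unitsField (toUField U₀)) x₀) < 2 * α * (((P.L : ℝ) ^ k)⁻¹) ^ 2 := pdev_pull_lt hα h₀ x₀
  have h34 : pdev (pull (unitsField (toUField U)) x₀) < 2 * α * (((P.L : ℝ) ^ k)⁻¹) ^ 2 := pdev_pull_lt hα hU x₀
  have T := pinnedTwistedFix_global P.L hL2 hG k _ _ hmem₀ hmem h2α hα3 hα2 h33 h34
  obtain ⟨hwG, -, -, htop, -, -⟩ := T
  -- periodicity of the pinned twisted fix, with the full period `sitesPerDir 0 = sitesPerDir k · Lᵏ`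
  have hper : ∀ (z : LSite P.d) (i : Fin P.d),
      ptw P.L (pull (unitsField (toUField U₀)) x₀) (pull (unitsField (toUField U)) x₀) k (z + ((P.sitesPerDir 0 : ℕ) : ℤ) • e i) =
        ptw P.L (pull (unitsField (toUField U₀)) x₀) (pull (unitsField (toUField U)) x₀) k z := by
    intro z i
    rw [sitesPerDir_zero_eq_mul_pow hk]
    exact ptw_periodic hL1 (P.sitesPerDir k) k (fun i => pull_periodic_pow hk _ x₀ i) (fun i => pull_periodic_pow hk _ x₀ i) z i
  obtain ⟨v, hv⟩ := exists_su_gauge_of_periodic hwG hper x₀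
  refine ⟨v, fun y => ?_, fun Λ => ?_⟩
  · rw [embIter_eq_transl hk y]
    exact eq_one_of_pullGauge_eq hv (htop _)
  · rw [pull_toUField_gaugeAct, hv]
    exact inAx_pinnedTwistedFix P.L hL2 hG k _ _ hmem₀ hmem h2α hα3 hα2 h33 h34 Λ

end Main

/-! ## §4 At the T³ carrier: the conditional axial-representative law of the corrected knit for print's (based) letters -/

section T3

open scoped Matrix.Norms.L2Operator
open Literature.MathematicalPhysics.QuantumFieldTheory.Balaban1983to89.T3ContinuumYM3Torus
open Literature.MathematicalPhysics.QuantumFieldTheory.Balaban1983to89.T3UnitLawDensityEML (ℰp)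
open Literature.MathematicalPhysics.QuantumFieldTheory.Balaban1983to89.T3DescentFibreTower
open Literature.MathematicalPhysics.QuantumFieldTheory.Balaban1983to89.T3PrintedRegularMinimiser
open Literature.MathematicalPhysics.QuantumFieldTheory.Balaban1983to89.T3PrintedMinimiserExistence (regPr_mono)
open Literature.MathematicalPhysics.QuantumFieldTheory.Balaban1983to89.T3PrintedRegularOrbits (descTransf)
open T3SectALandauChart (Resid Sat14T3 pos_of_regPr)

variable (F : T3Family) {n K : ℕ} (h : n ≤ K)

/-- **THE ORIGIN-BASED CLASS `InAk` OF A PRINTED-REGULAR CONFIGURATION** (`T3PrintedRegularMinimiser.RegPr ε₀ U`, both clauses of (2), read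
through `regPr_iff_inSpace` and `B8Thm2SetupTorus.inSpace_univ_iff_inAk_pull`). [cite: Balaban1985Variational, (2) p.278; Balaban1985RegularSpaces, (1.7)-(1.9) p.77] -/
theorem inAk_pull_of_regPr {ε₀ : ℝ} (hε : 0 ≤ ε₀) {U : GaugeField (F.P K) 0 (Matrix.specialUnitaryGroup (Fin 2) ℂ)} (hU : RegPr F n K ε₀ U) :
    InAk (F.P K).L (K - n) (((F.L : ℝ)⁻¹) ^ (K - n)) ε₀ (fun _ => (Set.univ : Set (LSite (F.P K).d))) (pull (unitsField (toUField U)) 0) :=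
  (inSpace_univ_iff_inAk_pull (K - n) ε₀ _ (toUField U)).1 ((regPr_iff_inSpace hε U).1 hU)

/-- **THE CONDITIONAL AXIAL-REPRESENTATIVE LAW OF THE CORRECTED KNIT, PROVED FOR PRINT'S (BASED) LETTERS AT THE T³ CARRIER.**  For every member
(`F`, `n ≤ K`, `k = K − n`) and every radius cap `C₁ ≥ 1` for the background there is a threshold `e > 0` (explicit: `min{1/(6C₀C₁), c₂′/(4C₁)}`)
such that: every `U ∈ (6)(ε₀)` with `ε₀ ≤ e`, `B₃ε₁ ≤ ε₀`, over a background `U₀` with (14) at radii `(C₁B₃ε₁, C₁ε₁)`, has an image under the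
group (4) (`descTransf v = 1`) in print's axial gauge (1.19) relative to `U₀`, read as `B8Eq119TwistedAxial.InAx` on the pullbacks BASED AT THE
`k`-CENTRE `embIter k 0` — for every presentation `S` whose `IsAxial` is implied by that reading.  This is the hypothesis `hax` of
`Prop7ChartInjectivity.prop7From14At_of_props_inj` (v1.1 binder shape, with `B₃ε₁ ≤ ε₀`) for print's presentation.
[cite: Balaban1985RegularSpaces, p.79 (sentence after (1.20)), (1.19) p.79; Balaban1985Variational, (4) p.278, (14) and (18) p.280] -/
theorem axialRepr_print_based (S : Resid F n K)
    (hS : ∀ U₀ U : GaugeField (F.P K) 0 (Matrix.specialUnitaryGroup (Fin 2) ℂ),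
      InAx (F.P K).L (K - n) (torusLam (K - n)) (pull (unitsField (toUField U₀)) (embIter (K - n) (0 : Site (F.P K) (K - n))))
        (pull (unitsField (toUField U)) (embIter (K - n) (0 : Site (F.P K) (K - n)))) → S.IsAxial U₀ U)
    {C₁ : ℝ} (hC₁ : 1 ≤ C₁) (B₃ : ℝ) :
    ∃ e : ℝ, 0 < e ∧ ∀ (ε₀ ε₁ : ℝ) (V : GaugeField (F.P n) 0 (Matrix.specialUnitaryGroup (Fin 2) ℂ))
      (U₀ U : GaugeField (F.P K) 0 (Matrix.specialUnitaryGroup (Fin 2) ℂ)), ε₀ ≤ e → B₃ * ε₁ ≤ ε₀ →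
      Sat14T3 F n K h (C₁ * B₃ * ε₁) (C₁ * ε₁) V U₀ → U ∈ regFibrePr F n K h ε₀ V →
        ∃ v : GaugeTransf (F.P K) 0 (Matrix.specialUnitaryGroup (Fin 2) ℂ), descTransf F n K h v = (fun _ => 1) ∧ S.IsAxial U₀ (GaugeField.gaugeAct v U) := by
  have hC0 : 0 < C0 (F.P K).d := C0_pos _
  have hc2 : 0 < c2' (F.P K).d (F.P K).L := c2'_pos _ _ (F.P K).hL.2.le
  have hC₁0 : 0 < C₁ := by linarith
  refine ⟨min (1 / (6 * C0 (F.P K).d * C₁)) (c2' (F.P K).d (F.P K).L / (4 * C₁)), lt_min (by positivity) (by positivity), ?_⟩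
  intro ε₀ ε₁ V U₀ U hεe hB₃ε h14 hU
  obtain ⟨-, hreg⟩ := (mem_regFibrePr_iff F).mp hU
  have hε₀ : 0 < ε₀ := pos_of_regPr F hreg
  -- both configurations are printed-regular at the radius `a := C₁ε₀`
  set a : ℝ := C₁ * ε₀ with ha
  have ha0 : 0 < a := by positivity
  have hεa : ε₀ ≤ a := by simp only [ha]; nlinarith
  have h₁a : C₁ * B₃ * ε₁ ≤ a := by simp only [ha]; nlinarith
  have hregU : RegPr F n K a U := regPr_mono F hεa hreg
  have hreg₀ : RegPr F n K a U₀ := regPr_mono F h₁a h14.1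
  -- the Prop.-2 window for `α := a`
  have he1 : ε₀ ≤ 1 / (6 * C0 (F.P K).d * C₁) := hεe.trans (min_le_left _ _)
  have he2 : ε₀ ≤ c2' (F.P K).d (F.P K).L / (4 * C₁) := hεe.trans (min_le_right _ _)
  have hα3 : C0 (F.P K).d * (2 * a) ≤ 1 / 3 := by
    have := (le_div_iff₀ (by positivity)).1 he1
    simp only [ha]; nlinarith
  have hα2 : 2 * (2 * a) ≤ c2' (F.P K).d (F.P K).L := by
    have := (le_div_iff₀ (by positivity)).1 he2
    simp only [ha]; nlinarith
  have hk : K - n ≤ (F.P K).m + (F.P K).K := by show K - n ≤ F.m + K; omega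
  obtain ⟨v, hv1, hvAx⟩ := exists_repr_inAx_based (P := F.P K) (by norm_num) hk ha0 hα3 hα2 U₀ U
    (inAk_pull_of_regPr F ha0.le hreg₀) (inAk_pull_of_regPr F ha0.le hregU)
  refine ⟨v, ?_, hS U₀ _ (hvAx _)⟩
  funext x
  unfold descTransf
  rw [transfUp_eq_embIter]
  exact hv1 _

end T3

/-! ## §5 Print's injectivity law for the SAME based letters (the `ℤᵈ` core of `Prop7ChartInjectivityPrint`, any base point) -/

section Injectivity

open scoped Matrix.Norms.L2Operator
open B8Eq119TwistedAxial (Restr129)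
open B7Eq92Concrete (mgauge mgauge_mul)
open Summit.QuantumFields.YangMills.Theorems.Prop7ChartInjectivityPrint (eq_of_inAx_restr129)

variable {P : Params} {N : ℕ} [NeZero N]

/-- **PRINT'S INJECTIVITY «u = u′» FOR THE BASED LETTERS** ([Balaban1985Variational] p. 281 «The above mapping is one-to-one»; [Balaban1985Averaging]
p. 31): if `u, u′` satisfy (1.29) relative to `U₀` and `(U₁U₀)^u`, `(U₁U₀)^{u′}` both lie in `Ax_k(T^{(k)}, U₀)`, everything read on the pullbacks
based at ANY torus site `x₀`, then `u = u′` (`Prop7ChartInjectivityPrint.eq_of_inAx_restr129` on the pullbacks; a based pullback of a gauge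
transformation determines it, `B8Thm2SetupTorus.pullGauge_descendGauge` read backwards through `transl_rel`).
[cite: Balaban1985Variational, p.281 («The above mapping is one-to-one»); Balaban1985Averaging, (87) p.31; Balaban1985RegularSpaces, (1.29) p.81] -/
theorem eq_of_inAx_restr129_based (k : ℕ) (x₀ : Site P 0) (U₀ U₁ : GaugeField P 0 (Matrix.specialUnitaryGroup (Fin N) ℂ))
    {u u' : GaugeTransf P 0 (Matrix.specialUnitaryGroup (Fin N) ℂ)}
    (hu : Restr129 P.L k (torusLam k) (pull (unitsField (toUField U₀)) x₀) (pullGauge (fun x => Unitary.toUnits (toUGauge P N u x)) x₀))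
    (hu' : Restr129 P.L k (torusLam k) (pull (unitsField (toUField U₀)) x₀) (pullGauge (fun x => Unitary.toUnits (toUGauge P N u' x)) x₀))
    (hAx : InAx P.L k (torusLam k) (pull (unitsField (toUField U₀)) x₀)
      (pull (unitsField (toUField (GaugeField.gaugeAct u (fun b => U₁ b * U₀ b)))) x₀))
    (hAx' : InAx P.L k (torusLam k) (pull (unitsField (toUField U₀)) x₀)
      (pull (unitsField (toUField (GaugeField.gaugeAct u' (fun b => U₁ b * U₀ b)))) x₀)) : u = u' := by
  have hL : 1 ≤ P.L := P.hL.2.le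
  have hmul : pull (unitsField (toUField (fun b => U₁ b * U₀ b))) x₀ = pull (unitsField (toUField U₁)) x₀ * pull (unitsField (toUField U₀)) x₀ := by
    funext z μ
    simp only [pull_apply, Pi.mul_apply]
    apply Units.ext
    rw [val_unitsField, Units.val_mul, val_unitsField, val_unitsField]
    rfl
  rw [pull_toUField_gaugeAct, hmul, ← mgauge_mul] at hAx hAx'
  have key := eq_of_inAx_restr129 hL hAx hu hAx' hu'
  -- a based pullback determines the torus gauge transformation: evaluate at `rel x₀ x`
  funext x
  have hx := congrFun key (rel x₀ x)
  simp only [pullGauge_apply, transl_rel] at hx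
  have hx' := congrArg (fun g : (Matrix (Fin N) (Fin N) ℂ)ˣ => (g : Matrix (Fin N) (Fin N) ℂ)) hx
  simp only [Unitary.val_toUnits_apply, B8Thm2SetupTorus.toUGauge_apply, val_suIncl] at hx'
  exact Subtype.ext hx'

end Injectivity

section T3Inj

open scoped Matrix.Norms.L2Operator
open B8Eq119TwistedAxial (Restr129)
open Literature.MathematicalPhysics.QuantumFieldTheory.Balaban1983to89.T3ContinuumYM3Torus
open Literature.MathematicalPhysics.QuantumFieldTheory.Balaban1983to89.T3PrintedRegularMinimiser (regFibrePr)
open T3SectALandauChart (Resid emb15)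

variable (F : T3Family) {n K : ℕ} (h : n ≤ K)

/-- **PRINT'S INJECTIVITY LAW AT THE T³ CARRIER FOR THE BASED LETTERS, IN THE KNIT'S BINDER SHAPE** (the hypothesis `hinj` of
`Prop7ChartInjectivity.prop7From14At_of_props_inj`): for every presentation `S` whose `IsAxial` implies the (1.19)-reading and whose `Restricted`
implies the (1.29)-reading on the pullbacks based at the `k`-centre `embIter k 0`, two restricted gauge transformations whose images of `U₁U₀` both
lie in (18) are equal. [cite: Balaban1985Variational, p.281 («The above mapping is one-to-one»), (16)–(18) p.280; Balaban1985Averaging, (87) p.31] -/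
theorem inj16_print_based (S : Resid F n K)
    (hSax : ∀ U₀ U : GaugeField (F.P K) 0 (Matrix.specialUnitaryGroup (Fin 2) ℂ), S.IsAxial U₀ U →
      InAx (F.P K).L (K - n) (torusLam (K - n)) (pull (unitsField (toUField U₀)) (embIter (K - n) (0 : Site (F.P K) (K - n))))
        (pull (unitsField (toUField U)) (embIter (K - n) (0 : Site (F.P K) (K - n)))))
    (hSre : ∀ (U₀ : GaugeField (F.P K) 0 (Matrix.specialUnitaryGroup (Fin 2) ℂ)) (u : GaugeTransf (F.P K) 0 (Matrix.specialUnitaryGroup (Fin 2) ℂ)),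
      S.Restricted U₀ u → Restr129 (F.P K).L (K - n) (torusLam (K - n)) (pull (unitsField (toUField U₀)) (embIter (K - n) (0 : Site (F.P K) (K - n))))
        (pullGauge (fun x => Unitary.toUnits (toUGauge (F.P K) 2 u x)) (embIter (K - n) (0 : Site (F.P K) (K - n)))))
    (ε₀ : ℝ) (V : GaugeField (F.P n) 0 (Matrix.specialUnitaryGroup (Fin 2) ℂ))
    (U₀ U₁ : GaugeField (F.P K) 0 (Matrix.specialUnitaryGroup (Fin 2) ℂ)) (u u' : GaugeTransf (F.P K) 0 (Matrix.specialUnitaryGroup (Fin 2) ℂ))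
    (hu : S.Restricted U₀ u) (hu' : S.Restricted U₀ u')
    (_h6 : GaugeField.gaugeAct u (emb15 U₀ U₁) ∈ regFibrePr F n K h ε₀ V) (hax : S.IsAxial U₀ (GaugeField.gaugeAct u (emb15 U₀ U₁)))
    (_h6' : GaugeField.gaugeAct u' (emb15 U₀ U₁) ∈ regFibrePr F n K h ε₀ V) (hax' : S.IsAxial U₀ (GaugeField.gaugeAct u' (emb15 U₀ U₁))) :
    u = u' :=
  eq_of_inAx_restr129_based (K - n) _ U₀ U₁ (hSre U₀ u hu) (hSre U₀ u' hu') (hSax _ _ hax) (hSax _ _ hax')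

end T3Inj

end Summit.QuantumFields.YangMills.Theorems.Prop7AxialReprPrint

end
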